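import Literature.NumberTheory.Sieve.CFSemigroupTransfer
import Literature.NumberTheory.Sieve.CFSemigroupHensley
import HarnessLib

/-!
# The renewal equation of the continued-fractions semigroup

Support file (all results proved) for the named fact
`Literature.NumberTheory.Sieve.MageeOhWinter2019_uniformCounting` (`CFSemigroupCounting.lean`).
[MageeOhWinter2019, §3] converts the lattice-point count into the dynamical counting function
`N(a, x) = Σ_n Σ_{Tⁿ y = x} 1{τ_n(y) ≤ a}` (Lalley), which satisfies the **renewal equation**
(3.1) `N(a, x) = Σ_{T y = x} N(a - τ(y), y) + 1{a ≥ 0}`; the Main Theorem 11 is then obtained by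
Laplace transform in `a` and the spectral theory of the transfer operators `L_s`. For `Γ_A` the
inverse branches of `Tⁿ` at `x ∈ [0,1]` are the word maps `M_w`, `w ∈ Aⁿ`, with
`τ_n = log |(Tⁿ)'| = 2 log denom(M_w, x)` (`denom(M_w, x) = q'(w) x + q(w)`,
`CFSemigroupTransfer.lean`), so in the multiplicative variable `X = e^{a/2}` the counting
function is `N_N(X, x) = #{w ∈ A^{≤ N} : denom(M_w, x) ≤ X}` (`cfDynCount`; the length cut-off
`N` is immaterial once `2^N > X²`, `cfDynCount_stable`). We prove:

* `cfDynCount_succ` — **the renewal equation**, exactly: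
  `N_{N+1}(X, x) = 1{X ≥ 1} + Σ_{a ∈ A} N_N(X/(x+a), 1/(x+a))` (`x ∈ [0,1]`), from the cocycle
  `denom(M_w g_a, x) = (x + a) denom(M_w, g_a x)`;
* `cfDynCount_le`, `le_cfDynCount` — comparison with the word counts of
  `CFSemigroupHensley.lean` (`q(w) ≤ denom(M_w, x) ≤ 2 q(w)` on `[0,1]`) and hence the a priori
  bounds `c X^{2δ_A} ≤ N_N(X, x) ≤ C X^{2δ_A}` (`cfDynCount_asymp_bounds`), the order of growth
  that the renewal THEOREM (Lalley; [MageeOhWinter2019, Thm. 11 / Prop. 17]) sharpens to an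
  asymptotic `~ c(x) X^{2δ_A}`.

## References

* M. Magee, H. Oh, D. Winter, J. reine angew. Math. 753 (2019) 89–135, §3, eq. (3.1), (3.4).
  [MageeOhWinter2019]
* S. P. Lalley, *Renewal theorems in symbolic dynamics, with applications to geodesic flows,
  noneuclidean tessellations and their fractal limits*, Acta Math. 163 (1989) 1–55, eq. (2.1).
-/

noncomputable section

open Filter Set
open scoped Classical

namespace Literature.NumberTheory.Sieve

variable {A : Finset ℕ}

/-! ### The dynamical counting function -/

variable (A) in
/-- The **dynamical counting function** `N_N(X, x) = #{w ∈ A^{≤N} : denom(M_w, x) ≤ X}`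
(Lalley's `N(a, x)` for `Γ_A` with `G ≡ 1`, in the variable `X = e^{a/2}`, truncated at word
length `N`). [cite: MageeOhWinter2019, §3] -/
def cfDynCount (N : ℕ) (X x : ℝ) : ℝ :=
  ∑ n ∈ Finset.range (N + 1), ∑ w : Fin n → A,
    if cfDenom (cfMat fun i => (w i : ℕ)) x ≤ X then (1 : ℝ) else 0

/-- `N_N(X, x) ≥ 0`. [folklore] -/
theorem cfDynCount_nonneg (N : ℕ) (X x : ℝ) : 0 ≤ cfDynCount A N X x :=
  Finset.sum_nonneg fun _ _ => Finset.sum_nonneg fun _ _ => by split_ifs <;> norm_num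

/-- The empty word contributes `1{X ≥ 1}`: `N_0(X, x) = 1{1 ≤ X}`. [folklore] -/
theorem cfDynCount_zero (X x : ℝ) : cfDynCount A 0 X x = if 1 ≤ X then 1 else 0 := by
  simp [cfDynCount, cfDenom, cfMat]

/-- **The renewal equation** ([MageeOhWinter2019, (3.1)] for `Γ_A`, `G ≡ 1`, exactly):
`N_{N+1}(X, x) = 1{X ≥ 1} + Σ_{a ∈ A} N_N(X/(x + a), 1/(x + a))` for `x ∈ [0,1]` — a word is
empty or ends with a letter `a`, and `denom(M_w g_a, x) = (x + a) · denom(M_w, g_a · x)`.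
[cite: MageeOhWinter2019, §3 eq. (3.1)] -/
theorem cfDynCount_succ (hA : ∀ a ∈ A, 1 ≤ a) (N : ℕ) (X : ℝ) {x : ℝ} (hx : x ∈ Icc (0 : ℝ) 1) :
    cfDynCount A (N + 1) X x =
      (if 1 ≤ X then 1 else 0) + ∑ a ∈ A, cfDynCount A N (X / (x + a)) (1 / (x + a)) := by
  rw [cfDynCount, Finset.sum_range_succ', add_comm]
  congr 1
  · simp [cfDenom, cfMat]
  · -- words of length `n + 1`, split off the last letter
    simp only [cfDynCount]
    rw [Finset.sum_comm]
    refine Finset.sum_congr rfl fun n _ => ?_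
    rw [← (Fin.appendEquiv n 1).sum_comp, Fintype.sum_prod_type, Finset.sum_comm,
      ← Finset.sum_coe_sort A, ← (Equiv.funUnique (Fin 1) A).sum_comp]
    refine Finset.sum_congr rfl fun v _ => Finset.sum_congr rfl fun w _ => ?_
    simp only [Fin.appendEquiv_apply, Equiv.funUnique_apply, Fin.default_eq_zero]
    rw [coe_append, cfMat_append, cfMat_fin_one]
    have hw : ∀ i, 1 ≤ (fun i => (w i : ℕ)) i := one_le_coe_digit hA w
    have ha1 : (1 : ℝ) ≤ ((v 0 : A) : ℕ) := by exact_mod_cast hA _ (v 0).2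
    have hxa : 0 < x + ((v 0 : A) : ℕ) := by linarith [hx.1]
    have hxa' : cfDenom (cfGen ((v 0 : A) : ℕ)) x ≠ 0 := by rw [cfDenom_cfGen]; exact hxa.ne'
    rw [cfDenom_mul _ _ hxa', cfDenom_cfGen, cfMoeb_cfGen]
    simp only [le_div_iff₀ hxa]
    rw [mul_comm (x + (((v 0 : A) : ℕ) : ℝ))]

/-- Beyond the cut-off nothing is counted: if `X² < 2^N` then `N_M(X, x) = N_N(X, x)` for all
`M ≥ N` and `x ∈ [0,1]` (`denom(M_w, x) ≥ q(w) ≥ 2^{(|w|-1)/2}`). [folklore] -/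
theorem cfDynCount_stable (hA : ∀ a ∈ A, 1 ≤ a) {N : ℕ} {X : ℝ} (hX : X ^ 2 < (2 : ℝ) ^ N) {x : ℝ}
    (hx : x ∈ Icc (0 : ℝ) 1) {M : ℕ} (hM : N ≤ M) : cfDynCount A M X x = cfDynCount A N X x := by
  rw [cfDynCount, cfDynCount]
  have hsub : Finset.range (N + 1) ⊆ Finset.range (M + 1) := Finset.range_subset_range.2 (by omega)
  rw [← Finset.sum_subset hsub]
  intro n hn hnN
  rw [Finset.mem_range] at hn hnN
  refine Finset.sum_eq_zero fun w _ => ?_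
  have hw : ∀ i, 1 ≤ (fun i => (w i : ℕ)) i := one_le_coe_digit hA w
  have hden := (cfDenom_cfMat_mem hw hx).1
  have hgrow : ((2 : ℤ) ^ (n - 1) : ℝ) ≤ (((cfQ fun i => (w i : ℕ)) : ℤ) : ℝ) ^ 2 := by
    exact_mod_cast pow_le_cfQ_sq hw
  push_cast at hgrow
  have hpow : (2 : ℝ) ^ N ≤ (2 : ℝ) ^ (n - 1) := pow_le_pow_right₀ (by norm_num) (by omega)
  have hq0 : (0 : ℝ) ≤ ((cfQ fun i => (w i : ℕ)) : ℝ) := by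
    exact_mod_cast (zero_le_one.trans (one_le_cfQ hw))
  rw [if_neg]
  intro hle
  have hX0 : X < ((cfQ fun i => (w i : ℕ)) : ℝ) := by
    by_contra h
    push Not at h
    have hXnn : 0 ≤ X := hq0.trans h
    nlinarith [pow_le_pow_left₀ hq0 h 2]
  linarith

/-! ### Comparison with word counts and the a priori bounds -/

/-- The word count as a sum of indicators. [folklore] -/
theorem card_cfWordsLE_eq_sum (N : ℕ) (R : ℝ) :
    ((cfWordsLE A N R).card : ℝ) = ∑ n ∈ Finset.range (N + 1), ∑ w : Fin n → A,
      if ((cfQ fun i => (w i : ℕ)) : ℝ) ≤ R then (1 : ℝ) else 0 := by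
  rw [cfWordsLE, Finset.card_sigma]
  push_cast
  refine Finset.sum_congr rfl fun n _ => ?_
  rw [Finset.sum_boole, Nat.cast_inj]

/-- `N_N(X, x) ≤ #{w ∈ A^{≤N} : q(w) ≤ X}` for `x ∈ [0,1]` (`denom ≥ q`). [folklore] -/
theorem cfDynCount_le (hA : ∀ a ∈ A, 1 ≤ a) (N : ℕ) (X : ℝ) {x : ℝ} (hx : x ∈ Icc (0 : ℝ) 1) :
    cfDynCount A N X x ≤ ((cfWordsLE A N X).card : ℝ) := by
  rw [card_cfWordsLE_eq_sum, cfDynCount]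
  refine Finset.sum_le_sum fun n _ => Finset.sum_le_sum fun w _ => ?_
  have hden := (cfDenom_cfMat_mem (one_le_coe_digit hA w) hx).1
  split_ifs with h1 h2 <;> first | rfl | norm_num
  exact h2 (hden.trans h1)

/-- `#{w ∈ A^{≤N} : q(w) ≤ X/2} ≤ N_N(X, x)` for `x ∈ [0,1]` (`denom ≤ 2q`). [folklore] -/
theorem le_cfDynCount (hA : ∀ a ∈ A, 1 ≤ a) (N : ℕ) (X : ℝ) {x : ℝ} (hx : x ∈ Icc (0 : ℝ) 1) :
    ((cfWordsLE A N (X / 2)).card : ℝ) ≤ cfDynCount A N X x := by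
  rw [card_cfWordsLE_eq_sum, cfDynCount]
  refine Finset.sum_le_sum fun n _ => Finset.sum_le_sum fun w _ => ?_
  have hden := (cfDenom_cfMat_mem (one_le_coe_digit hA w) hx).2
  split_ifs with h1 h2 <;> first | rfl | norm_num
  exact h2 (by linarith)

/-- The section injects into the short words: `#S_Y^{≤N} ≤ #{w ∈ A^{≤N} : q(w) ≤ (B+1) Y}`
for `Y ≥ 1`. [folklore] -/
theorem card_cfSec_le_card_cfWordsLE (hA : ∀ a ∈ A, 1 ≤ a) (hne : A.Nonempty) {B : ℕ}
    (hB : ∀ a ∈ A, a ≤ B) {Y : ℝ} (hY : 1 ≤ Y) (N : ℕ) :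
    (cfSec A Y N).card ≤ (cfWordsLE A N (((B : ℝ) + 1) * Y)).card := by
  refine Finset.card_le_card fun z hz => ?_
  rw [mem_cfSec] at hz
  rw [mem_cfWordsLE]
  exact ⟨hz.1, cfQk_le_of_cfStop hA hB hne hY hz.2⟩

/-- **A priori bounds for the dynamical count** (the order of growth that the renewal theorem
refines): there are `X₀, c, C > 0` such that for all `X ≥ X₀`, all `x ∈ [0,1]` and all cut-offs
`N` with `2^N > X²`, `c X^{2δ_A} ≤ N_N(X, x) ≤ C X^{2δ_A}`. [cite: MageeOhWinter2019, Thm. 11] -/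
theorem cfDynCount_asymp_bounds (hA : ∀ a ∈ A, 1 ≤ a) (h2 : 2 ≤ A.card) :
    ∃ X₀ : ℝ, 0 < X₀ ∧ ∃ c : ℝ, 0 < c ∧ ∃ C : ℝ, 0 < C ∧ ∀ X : ℝ, X₀ ≤ X → ∀ x ∈ Icc (0 : ℝ) 1,
      ∀ N : ℕ, X ^ 2 < (2 : ℝ) ^ N →
        c * X ^ (2 * cfDimension A) ≤ cfDynCount A N X x ∧
          cfDynCount A N X x ≤ C * X ^ (2 * cfDimension A) := by
  have hne := nonempty_of_two_le_card h2
  set δ := cfDimension A with hδ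
  have hδ0 : 0 < δ := cfDimension_pos hA h2
  set B : ℕ := A.max' hne with hBdef
  have hB : ∀ a ∈ A, a ≤ B := fun a ha => A.le_max' a ha
  have hZ1 : ∀ m, 1 ≤ cfPartition A m δ := fun m => (cfPartition_cfDimension_mem_Icc hA h2 m).1
  have hZ4 : ∀ m, cfPartition A m δ ≤ (4 : ℝ) ^ δ := fun m => (cfPartition_cfDimension_mem_Icc hA h2 m).2
  have hB1 : (0 : ℝ) < (B : ℝ) + 1 := by positivity
  -- `X₀ = 2(B+1)`, so that `Y = X/(2(B+1)) ≥ 1`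
  refine ⟨2 * ((B : ℝ) + 1), by positivity,
    (4 : ℝ) ^ (-δ) * ((2 * ((B : ℝ) + 1)) ^ 2) ^ (-δ), by positivity,
    cfUpperConst h2, cfUpperConst_pos hA h2, fun X hX x hx N hN => ⟨?_, ?_⟩⟩
  · -- lower bound through the section `S_Y`, `Y = X / (2(B+1))`
    have hX0 : 0 < X := lt_of_lt_of_le (by positivity) hX
    have hY : 1 ≤ X / (2 * ((B : ℝ) + 1)) := by rw [le_div_iff₀ (by positivity)]; linarith
    have hY0 : 0 < X / (2 * ((B : ℝ) + 1)) := by positivity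
    have hNY : (X / (2 * ((B : ℝ) + 1))) ^ 2 < (2 : ℝ) ^ (N + 1 - 1) := by
      rw [Nat.add_sub_cancel]
      have : (X / (2 * ((B : ℝ) + 1))) ^ 2 ≤ X ^ 2 := by
        apply pow_le_pow_left₀ hY0.le
        rw [div_le_iff₀ (by positivity)]
        nlinarith
      linarith
    have hsec := le_card_cfSec hA hδ0.le hZ4 (hZ1 (N + 1)) hY0 hNY
    have hinj := card_cfSec_le_card_cfWordsLE hA hne hB hY (N + 1)
    have hXeq : ((B : ℝ) + 1) * (X / (2 * ((B : ℝ) + 1))) = X / 2 := by field_simp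
    rw [hXeq] at hinj
    have hwords : ((cfWordsLE A (N + 1) (X / 2)).card : ℝ) ≤ cfDynCount A (N + 1) X x :=
      le_cfDynCount hA (N + 1) X hx
    rw [cfDynCount_stable hA hN hx (Nat.le_succ N)] at hwords
    have hchain : (4 : ℝ) ^ (-δ) * ((X / (2 * ((B : ℝ) + 1))) ^ 2) ^ δ ≤ cfDynCount A N X x :=
      hsec.trans ((by exact_mod_cast hinj : ((cfSec A (X / (2 * ((B : ℝ) + 1))) (N + 1)).card : ℝ) ≤
        ((cfWordsLE A (N + 1) (X / 2)).card : ℝ)).trans hwords)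
    refine le_trans (le_of_eq ?_) hchain
    rw [div_pow, Real.div_rpow (by positivity) (by positivity), sq_rpow_eq hX0.le,
      Real.rpow_neg (by positivity : (0 : ℝ) ≤ (2 * ((B : ℝ) + 1)) ^ 2)]
    ring
  · -- upper bound through the word count
    have hX1 : 1 ≤ X := le_trans (by linarith) hX
    refine (cfDynCount_le hA N X hx).trans ((card_cfWordsLE_le hA h2 N hX1).trans (le_of_eq ?_))
    rw [sq_rpow_eq (by linarith) δ]

end Literature.NumberTheory.Sieve
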